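import Summits.CriticalPhenomena.PercolationContinuityZ3.Theorems.PercNonProliferationFreeBoxSparseInfiniteReduction
import Summits.CriticalPhenomena.PercolationContinuityZ3.Theorems.PercNonProliferationFreeBoxSparseTorusParking
import HarnessLib

/-!
# Crux `PercNonProliferation.FreeBoxSparse` (stmt-CriticalPhenomena-4445) — the critical infinite cluster shatters in
# free boxes (probabilistic form of the finite/infinite reduction)

Helper file `--supports stmt-CriticalPhenomena-4445` (line lead c9), companion of
`PercNonProliferationFreeBoxSparseInfiniteReduction.lean` (pair-average form). Bond percolation on `ℤ³`, `Λ_n = box 3 n`,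
`K_Λ(x) = {v ∈ Λ : x ↔ v in Λ}` the FREE piece of `x`, `C(x)` the cluster of `x` in `ℤ³`, `{x ↔ ∞} = percolatesAt x`.

* `mul_indicator_le_sum_indicator_finiteRoot` (pointwise) — a free piece with `≥ s` points rooted at a non-percolating
  site has at least `s` such roots (all its points: `K_Λ(x') ⊇ K_Λ(x)` and `C(x') ⊆ C(x)` for `x' ∈ K_Λ(x)`);
* `real_exists_finite_dense_mul_le` (every `p`, finite `Λ`, `s`):
  `s · P_p(∃ x ∈ Λ, |C(x)| < ∞ ∧ s ≤ |K_Λ(x)|) ≤ |Λ| · P_p(s ≤ |C(0)| < ∞)`;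
* `tendsto_real_exists_finite_dense` (every `p`, `δ > 0`): dense FINITE free pieces of `Λ_n` have vanishing probability,
  `≤ δ⁻¹ P_p(⌈δ|Λ_n|⌉ ≤ |C(0)| < ∞) → 0` (`InfiniteReduction.tendsto_real_clusterTail_atTop`);
* `freeBoxSparse_iff_noInfiniteFreeGiant` — **the dictionary entry** (registered sub-goal):
  `FreeBoxSparse ⟺ ∀ δ > 0, P_{p_c}(∃ x ∈ Λ_n, x ↔ ∞ ∧ |K_{Λ_n}(x)| ≥ δ|Λ_n|) → 0`.

So the crux says exactly that the critical infinite cluster — if there is one — has no `δ`-dense `Λ_n`-connected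
fragment with non-vanishing probability ("`C_∞` shatters in free boxes"); under `θ(p_c) = 0` the right-hand side is
trivially `0`. No definitions; no sorry.
-/

noncomputable section

namespace Summit.CriticalPhenomena.PercolationContinuityZ3.Theorems.FreeBoxSparse.InfiniteReduction

open MeasureTheory Filter Topology
open scoped Classical
open Literature.Probability.Percolation Literature.Probability.LatticeModels
open Summit.CriticalPhenomena.PercolationContinuityZ3.Theses.PercNonProliferation (FreeBoxSparse)

/-! ## Dense free pieces: the FINITE ones are improbable; the crux is "the infinite cluster shatters" -/

/-- The size of the free piece `|K_Λ(x)| = #{v ∈ Λ : x ↔ v in Λ}` is a measurable function of the configuration.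
[folklore] -/
theorem measurable_card_piece (Λ : Finset (Site 3)) (x : Site 3) :
    Measurable fun ω : BondConfig (Site 3) =>
      (((Λ.filter fun v => ω ∈ openConnIn (↑Λ : Set (Site 3)) x v)).card : ℝ) := by
  classical
  have heq : (fun ω : BondConfig (Site 3) =>
      (((Λ.filter fun v => ω ∈ openConnIn (↑Λ : Set (Site 3)) x v)).card : ℝ)) =
      fun ω => ∑ v ∈ Λ, (openConnIn (↑Λ : Set (Site 3)) x v).indicator (1 : BondConfig (Site 3) → ℝ) ω := by
    funext ω
    rw [Finset.card_filter, Nat.cast_sum]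
    refine Finset.sum_congr rfl fun v _ => ?_
    by_cases h : ω ∈ openConnIn (↑Λ : Set (Site 3)) x v
    · simp [h]
    · simp [h]
  rw [heq]
  exact Finset.measurable_sum _ fun v _ => measurable_const.indicator (DCT16.measurableSet_openConnIn Λ x v)

/-- The root event "`C(x)` is finite and the free piece of `x` in `Λ` has at least `s` points" is measurable. [folklore] -/
theorem measurableSet_finiteRoot (Λ : Finset (Site 3)) (x : Site 3) (s : ℕ) :
    MeasurableSet {ω : BondConfig (Site 3) | ω ∉ percolatesAt x ∧
      (s : ℝ) ≤ (((Λ.filter fun v => ω ∈ openConnIn (↑Λ : Set (Site 3)) x v)).card : ℝ)} :=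
  (measurableSet_percolatesAt_holds x).compl.inter (measurableSet_le measurable_const (measurable_card_piece Λ x))

/-- The event "`Λ` has a free piece with at least `s` points rooted at a NON-percolating site" is measurable. [folklore] -/
theorem measurableSet_exists_finiteRoot (Λ : Finset (Site 3)) (s : ℕ) :
    MeasurableSet {ω : BondConfig (Site 3) | ∃ x ∈ Λ, ω ∉ percolatesAt x ∧
      (s : ℝ) ≤ (((Λ.filter fun v => ω ∈ openConnIn (↑Λ : Set (Site 3)) x v)).card : ℝ)} := by
  have : {ω : BondConfig (Site 3) | ∃ x ∈ Λ, ω ∉ percolatesAt x ∧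
      (s : ℝ) ≤ (((Λ.filter fun v => ω ∈ openConnIn (↑Λ : Set (Site 3)) x v)).card : ℝ)} =
      ⋃ x ∈ Λ, {ω | ω ∉ percolatesAt x ∧
        (s : ℝ) ≤ (((Λ.filter fun v => ω ∈ openConnIn (↑Λ : Set (Site 3)) x v)).card : ℝ)} := by
    ext ω
    simp only [Set.mem_setOf_eq, Set.mem_iUnion, exists_prop]
  rw [this]
  exact MeasurableSet.biUnion (Finset.countable_toSet Λ) fun x _ => measurableSet_finiteRoot Λ x s

/-- **Pointwise root count**: if some `x ∈ Λ` with `|C(x)| < ∞` has `|K_Λ(x)| ≥ s`, then at least `s` sites of `Λ` — all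
the points of `K_Λ(x)` — are such roots themselves (`K_Λ(x') ⊇ K_Λ(x)` and `C(x') ⊆ C(x)` for `x' ∈ K_Λ(x)`):
`s · 𝟙{∃ finite s-root} ≤ #{finite s-roots in Λ}`. [folklore] -/
theorem mul_indicator_le_sum_indicator_finiteRoot (Λ : Finset (Site 3)) (s : ℕ) (ω : BondConfig (Site 3)) :
    (s : ℝ) * {ω : BondConfig (Site 3) | ∃ x ∈ Λ, ω ∉ percolatesAt x ∧
        (s : ℝ) ≤ (((Λ.filter fun v => ω ∈ openConnIn (↑Λ : Set (Site 3)) x v)).card : ℝ)}.indicator 1 ω ≤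
      ∑ x' ∈ Λ, {ω : BondConfig (Site 3) | ω ∉ percolatesAt x' ∧
        (s : ℝ) ≤ (((Λ.filter fun v => ω ∈ openConnIn (↑Λ : Set (Site 3)) x' v)).card : ℝ)}.indicator 1 ω := by
  classical
  have hnn : 0 ≤ ∑ x' ∈ Λ, {ω : BondConfig (Site 3) | ω ∉ percolatesAt x' ∧
      (s : ℝ) ≤ (((Λ.filter fun v => ω ∈ openConnIn (↑Λ : Set (Site 3)) x' v)).card : ℝ)}.indicator
        (1 : BondConfig (Site 3) → ℝ) ω :=
    Finset.sum_nonneg fun x' _ => Set.indicator_nonneg (fun _ _ => zero_le_one) _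
  by_cases hω : ω ∈ {ω : BondConfig (Site 3) | ∃ x ∈ Λ, ω ∉ percolatesAt x ∧
      (s : ℝ) ≤ (((Λ.filter fun v => ω ∈ openConnIn (↑Λ : Set (Site 3)) x v)).card : ℝ)}
  · rw [Set.indicator_of_mem hω, Pi.one_apply, mul_one]
    obtain ⟨x, -, hxperc, hxcard⟩ := hω
    set P := Λ.filter fun v => ω ∈ openConnIn (↑Λ : Set (Site 3)) x v with hP
    -- every point of the piece `P` is a finite `s`-root
    have hroot : ∀ x' ∈ P, ω ∈ {ω : BondConfig (Site 3) | ω ∉ percolatesAt x' ∧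
        (s : ℝ) ≤ (((Λ.filter fun v => ω ∈ openConnIn (↑Λ : Set (Site 3)) x' v)).card : ℝ)} := by
      intro x' hx'
      have hxx' : ω ∈ openConnIn (↑Λ : Set (Site 3)) x x' := (Finset.mem_filter.1 hx').2
      refine ⟨?_, ?_⟩
      · -- `C(x') ⊆ C(x)` is finite
        intro hinf
        apply hxperc
        intro hfin
        refine hinf (hfin.subset fun z hz => ?_)
        exact (DCT16.reachable_of_pathIn (DCT16.pathIn_of_mem_openConnIn hxx')).trans hz
      · -- `K_Λ(x) ⊆ K_Λ(x')`
        refine hxcard.trans ?_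
        have hsub : P ⊆ Λ.filter fun v => ω ∈ openConnIn (↑Λ : Set (Site 3)) x' v := by
          intro v hv
          rw [Finset.mem_filter] at hv ⊢
          exact ⟨hv.1, mem_openConnIn_of_mem_piece hxx' hv.2⟩
        exact_mod_cast Finset.card_le_card hsub
    calc (s : ℝ) ≤ (P.card : ℝ) := hxcard
      _ = ∑ x' ∈ P, (1 : ℝ) := by simp
      _ = ∑ x' ∈ P, {ω : BondConfig (Site 3) | ω ∉ percolatesAt x' ∧
            (s : ℝ) ≤ (((Λ.filter fun v => ω ∈ openConnIn (↑Λ : Set (Site 3)) x' v)).card : ℝ)}.indicator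
              (1 : BondConfig (Site 3) → ℝ) ω := by
          refine Finset.sum_congr rfl fun x' hx' => ?_
          rw [Set.indicator_of_mem (hroot x' hx'), Pi.one_apply]
      _ ≤ _ := Finset.sum_le_sum_of_subset_of_nonneg (Finset.filter_subset _ Λ)
            fun x' _ _ => Set.indicator_nonneg (fun _ _ => zero_le_one) _
  · rw [Set.indicator_of_notMem hω, mul_zero]
    exact hnn

/-- **Dense finite free pieces have many roots** (every `p`, finite `Λ`, `s`):
`s · P_p(∃ x ∈ Λ, |C(x)| < ∞ ∧ s ≤ |K_Λ(x)|) ≤ |Λ| · P_p(s ≤ |C(0)| < ∞)` — integrate the pointwise root count; each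
root `x'` has `s ≤ |K_Λ(x')| ≤ |C(x')| < ∞`, an event of probability `P_p(s ≤ |C(0)| < ∞)` (translation invariance,
`Quarantine.real_clusterTail_eq_zero`). [folklore] -/
theorem real_exists_finite_dense_mul_le (p : unitInterval) (Λ : Finset (Site 3)) (s : ℕ) :
    (s : ℝ) * (bondPercolation (zdGraph 3) p).real {ω : BondConfig (Site 3) | ∃ x ∈ Λ, ω ∉ percolatesAt x ∧
        (s : ℝ) ≤ (((Λ.filter fun v => ω ∈ openConnIn (↑Λ : Set (Site 3)) x v)).card : ℝ)} ≤
      (Λ.card : ℝ) * (bondPercolation (zdGraph 3) p).real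
        {ω | (s : ℕ∞) ≤ (openCluster ω (0 : Site 3)).encard ∧ (openCluster ω (0 : Site 3)).Finite} := by
  classical
  set μ := bondPercolation (zdGraph 3) p with hμ
  set E := {ω : BondConfig (Site 3) | ∃ x ∈ Λ, ω ∉ percolatesAt x ∧
      (s : ℝ) ≤ (((Λ.filter fun v => ω ∈ openConnIn (↑Λ : Set (Site 3)) x v)).card : ℝ)} with hE
  set R : Site 3 → Set (BondConfig (Site 3)) := fun x' => {ω | ω ∉ percolatesAt x' ∧
      (s : ℝ) ≤ (((Λ.filter fun v => ω ∈ openConnIn (↑Λ : Set (Site 3)) x' v)).card : ℝ)} with hR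
  have hEm : MeasurableSet E := measurableSet_exists_finiteRoot Λ s
  have hRm : ∀ x', MeasurableSet (R x') := fun x' => measurableSet_finiteRoot Λ x' s
  set g : BondConfig (Site 3) → ℝ := fun ω => ∑ x' ∈ Λ, (R x').indicator (1 : BondConfig (Site 3) → ℝ) ω with hg
  have hint : ∀ x', Integrable (fun ω => (R x').indicator (1 : BondConfig (Site 3) → ℝ) ω) μ :=
    fun x' => (integrable_const (1 : ℝ)).indicator (hRm x')
  have hgint : Integrable g μ := integrable_finsetSum _ fun x' _ => hint x'
  -- `s · P(E) = ∫_E s ≤ ∫_E g ≤ ∫ g`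
  have hlow : ∀ ω ∈ E, (s : ℝ) ≤ g ω := by
    intro ω hω
    have h := mul_indicator_le_sum_indicator_finiteRoot Λ s ω
    rw [Set.indicator_of_mem hω, Pi.one_apply, mul_one] at h
    exact h
  have hstep1 : (s : ℝ) * μ.real E ≤ ∫ ω in E, g ω ∂μ :=
    setIntegral_ge_of_const_le_real hEm (measure_ne_top _ _) hlow hgint.integrableOn
  have hstep2 : ∫ ω in E, g ω ∂μ ≤ ∫ ω, g ω ∂μ :=
    setIntegral_le_integral hgint (Eventually.of_forall fun ω =>
      Finset.sum_nonneg fun x' _ => Set.indicator_nonneg (fun _ _ => zero_le_one) _)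
  have hstep3 : ∫ ω, g ω ∂μ = ∑ x' ∈ Λ, μ.real (R x') := by
    rw [hg, integral_finsetSum _ fun x' _ => hint x']
    exact Finset.sum_congr rfl fun x' _ => integral_indicator_one (hRm x')
  -- each root event is inside the finite-cluster tail event at `x'`, whose probability is root-free
  have hstep4 : ∀ x' ∈ Λ, μ.real (R x') ≤
      μ.real {ω | (s : ℕ∞) ≤ (openCluster ω (0 : Site 3)).encard ∧ (openCluster ω (0 : Site 3)).Finite} := by
    intro x' _
    rw [← Quarantine.real_clusterTail_eq_zero p x' s]
    refine measureReal_mono fun ω hω => ?_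
    obtain ⟨hperc, hcard⟩ := hω
    refine ⟨?_, not_not.1 fun hfin => hperc fun h => hfin (by exact h)⟩
    have h1 : (s : ℕ∞) ≤ (((Λ.filter fun v => ω ∈ openConnIn (↑Λ : Set (Site 3)) x' v)).card : ℕ∞) := by
      have : s ≤ (Λ.filter fun v => ω ∈ openConnIn (↑Λ : Set (Site 3)) x' v).card := by exact_mod_cast hcard
      exact_mod_cast this
    calc (s : ℕ∞) ≤ (((Λ.filter fun v => ω ∈ openConnIn (↑Λ : Set (Site 3)) x' v)).card : ℕ∞) := h1
      _ = (↑(Λ.filter fun v => ω ∈ openConnIn (↑Λ : Set (Site 3)) x' v) : Set (Site 3)).encard :=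
          (Set.encard_coe_eq_coe_finsetCard _).symm
      _ ≤ (openCluster ω x').encard :=
          Set.encard_le_encard (Quarantine.filter_openConnIn_subset_openCluster Λ x' ω)
  calc (s : ℝ) * μ.real E ≤ ∫ ω, g ω ∂μ := hstep1.trans hstep2
    _ = ∑ x' ∈ Λ, μ.real (R x') := hstep3
    _ ≤ ∑ _x' ∈ Λ, μ.real {ω | (s : ℕ∞) ≤ (openCluster ω (0 : Site 3)).encard ∧
          (openCluster ω (0 : Site 3)).Finite} := Finset.sum_le_sum hstep4
    _ = (Λ.card : ℝ) * _ := by rw [Finset.sum_const, nsmul_eq_mul]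

/-- **Dense FINITE free pieces are improbable, at every `p`**: for `δ > 0`,
`P_p(∃ x ∈ Λ_n, |C(x)| < ∞ ∧ |K_{Λ_n}(x)| ≥ δ|Λ_n|) ≤ δ⁻¹ · P_p(⌈δ|Λ_n|⌉ ≤ |C(0)| < ∞) → 0`. [folklore] -/
theorem tendsto_real_exists_finite_dense (p : unitInterval) {δ : ℝ} (hδ : 0 < δ) :
    Tendsto (fun n : ℕ => (bondPercolation (zdGraph 3) p).real {ω : BondConfig (Site 3) | ∃ x ∈ box 3 n,
      ω ∉ percolatesAt x ∧ δ * ((box 3 n).card : ℝ) ≤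
        ((((box 3 n).filter fun v => ω ∈ openConnIn (↑(box 3 n) : Set (Site 3)) x v)).card : ℝ)}) atTop (𝓝 0) := by
  set μ := bondPercolation (zdGraph 3) p with hμ
  set t : ℕ → ℝ := fun s => μ.real
    {ω | (s : ℕ∞) ≤ (openCluster ω (0 : Site 3)).encard ∧ (openCluster ω (0 : Site 3)).Finite} with ht
  -- the ceiling `s_n = ⌈δ|Λ_n|⌉ → ∞`, so `t (s_n) → 0`
  have hs : Tendsto (fun n : ℕ => ⌈δ * ((box 3 n).card : ℝ)⌉₊) atTop atTop := by
    have hcard : Tendsto (fun n : ℕ => ((box 3 n).card : ℝ)) atTop atTop :=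
      tendsto_atTop_mono (fun n => Negative.succ_le_card_box n)
        (tendsto_atTop_add_const_right _ 1 tendsto_natCast_atTop_atTop)
    exact tendsto_nat_ceil_atTop.comp (hcard.const_mul_atTop hδ)
  have ht0 : Tendsto (fun n : ℕ => t ⌈δ * ((box 3 n).card : ℝ)⌉₊) atTop (𝓝 0) :=
    (tendsto_real_clusterTail_atTop p).comp hs
  have hup : ∀ n, μ.real {ω : BondConfig (Site 3) | ∃ x ∈ box 3 n, ω ∉ percolatesAt x ∧
      δ * ((box 3 n).card : ℝ) ≤
        ((((box 3 n).filter fun v => ω ∈ openConnIn (↑(box 3 n) : Set (Site 3)) x v)).card : ℝ)} ≤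
      t ⌈δ * ((box 3 n).card : ℝ)⌉₊ / δ := by
    intro n
    set s : ℕ := ⌈δ * ((box 3 n).card : ℝ)⌉₊ with hsdef
    have hcpos : (0 : ℝ) < (box 3 n).card := by exact_mod_cast Finset.card_pos.2 (box_nonempty 3 n)
    have hspos : (0 : ℝ) < s := by
      have : 0 < δ * ((box 3 n).card : ℝ) := by positivity
      exact_mod_cast Nat.ceil_pos.2 this
    -- the real density threshold is the integer threshold `s`
    have hset : {ω : BondConfig (Site 3) | ∃ x ∈ box 3 n, ω ∉ percolatesAt x ∧
        δ * ((box 3 n).card : ℝ) ≤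
          ((((box 3 n).filter fun v => ω ∈ openConnIn (↑(box 3 n) : Set (Site 3)) x v)).card : ℝ)} =
        {ω : BondConfig (Site 3) | ∃ x ∈ box 3 n, ω ∉ percolatesAt x ∧
          (s : ℝ) ≤ ((((box 3 n).filter fun v => ω ∈ openConnIn (↑(box 3 n) : Set (Site 3)) x v)).card : ℝ)} := by
      ext ω
      simp only [Set.mem_setOf_eq]
      refine exists_congr fun x => and_congr_right fun _ => and_congr_right fun _ => ?_
      rw [hsdef]
      constructor
      · intro h; exact_mod_cast Nat.ceil_le.2 h
      · intro h; exact (Nat.le_ceil _).trans h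
    rw [hset, le_div_iff₀ hδ]
    have h1 := real_exists_finite_dense_mul_le p (box 3 n) s
    have h2 : δ * ((box 3 n).card : ℝ) ≤ s := Nat.le_ceil _
    -- `P(E) · δ|Λ| ≤ P(E) · s ≤ |Λ| · t s`
    have hP0 : 0 ≤ μ.real {ω : BondConfig (Site 3) | ∃ x ∈ box 3 n, ω ∉ percolatesAt x ∧
        (s : ℝ) ≤ ((((box 3 n).filter fun v => ω ∈ openConnIn (↑(box 3 n) : Set (Site 3)) x v)).card : ℝ)} :=
      measureReal_nonneg
    have h3 : μ.real {ω : BondConfig (Site 3) | ∃ x ∈ box 3 n, ω ∉ percolatesAt x ∧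
        (s : ℝ) ≤ ((((box 3 n).filter fun v => ω ∈ openConnIn (↑(box 3 n) : Set (Site 3)) x v)).card : ℝ)} *
          (δ * ((box 3 n).card : ℝ)) ≤ ((box 3 n).card : ℝ) * t s := by
      calc _ ≤ μ.real {ω : BondConfig (Site 3) | ∃ x ∈ box 3 n, ω ∉ percolatesAt x ∧
            (s : ℝ) ≤ ((((box 3 n).filter fun v => ω ∈ openConnIn (↑(box 3 n) : Set (Site 3)) x v)).card : ℝ)} * s :=
            mul_le_mul_of_nonneg_left h2 hP0
        _ = (s : ℝ) * _ := mul_comm _ _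
        _ ≤ ((box 3 n).card : ℝ) * t s := h1
    have h4 : μ.real {ω : BondConfig (Site 3) | ∃ x ∈ box 3 n, ω ∉ percolatesAt x ∧
        (s : ℝ) ≤ ((((box 3 n).filter fun v => ω ∈ openConnIn (↑(box 3 n) : Set (Site 3)) x v)).card : ℝ)} * δ *
          ((box 3 n).card : ℝ) ≤ t s * ((box 3 n).card : ℝ) := by nlinarith
    exact le_of_mul_le_mul_right h4 hcpos
  have hlim : Tendsto (fun n : ℕ => t ⌈δ * ((box 3 n).card : ℝ)⌉₊ / δ) atTop (𝓝 0) := by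
    simpa using ht0.div_const δ
  exact squeeze_zero (fun n => measureReal_nonneg) hup hlim

/-- **Dictionary (registered sub-goal): the crux says exactly that the critical infinite cluster has no dense free
fragment.** `FreeBoxSparse ⟺ ∀ δ > 0, P_{p_c}(∃ x ∈ Λ_n, x ↔ ∞ ∧ |K_{Λ_n}(x)| ≥ δ|Λ_n|) → 0`.
(`→`: the landed dictionary `TorusParking.freeBoxSparse_iff_noFreeGiant` and monotonicity; `←`: a dense free piece is
rooted either at a percolating site or at a non-percolating one, and the latter case has vanishing probability at every
`p`, `tendsto_real_exists_finite_dense`.) [folklore] -/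
theorem freeBoxSparse_iff_noInfiniteFreeGiant : Summit.CriticalPhenomena.PercolationContinuityZ3.Theses.PercNonProliferation.FreeBoxSparse ↔ ∀ δ : ℝ, 0 < δ → Tendsto (fun n : ℕ => (bondPercolation (zdGraph 3) (criticalProbI 3)).real {ω | ∃ x ∈ box 3 n, ω ∈ percolatesAt x ∧ δ * ((box 3 n).card : ℝ) ≤ ((((box 3 n).filter fun v => ω ∈ openConnIn (↑(box 3 n) : Set (Site 3)) x v)).card : ℝ)}) atTop (𝓝 0) := by
  set μ := bondPercolation (zdGraph 3) (criticalProbI 3) with hμ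
  rw [TorusParking.freeBoxSparse_iff_noFreeGiant]
  constructor
  · intro h δ hδ
    refine squeeze_zero (fun n => measureReal_nonneg) (fun n => measureReal_mono ?_) (h δ hδ)
    rintro ω ⟨x, hx, -, hcard⟩
    exact ⟨x, hx, hcard⟩
  · intro h δ hδ
    have hI := h δ hδ
    have hF := tendsto_real_exists_finite_dense (criticalProbI 3) hδ
    have hsum : Tendsto (fun n : ℕ =>
        μ.real {ω | ∃ x ∈ box 3 n, ω ∈ percolatesAt x ∧ δ * ((box 3 n).card : ℝ) ≤
          ((((box 3 n).filter fun v => ω ∈ openConnIn (↑(box 3 n) : Set (Site 3)) x v)).card : ℝ)} +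
        μ.real {ω : BondConfig (Site 3) | ∃ x ∈ box 3 n, ω ∉ percolatesAt x ∧ δ * ((box 3 n).card : ℝ) ≤
          ((((box 3 n).filter fun v => ω ∈ openConnIn (↑(box 3 n) : Set (Site 3)) x v)).card : ℝ)}) atTop (𝓝 0) := by
      simpa using hI.add hF
    refine squeeze_zero (fun n => measureReal_nonneg) (fun n => ?_) hsum
    refine (measureReal_mono ?_).trans (measureReal_union_le _ _)
    rintro ω ⟨x, hx, hcard⟩
    by_cases hperc : ω ∈ percolatesAt x
    · exact Or.inl ⟨x, hx, hperc, hcard⟩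
    · exact Or.inr ⟨x, hx, hperc, hcard⟩

end Summit.CriticalPhenomena.PercolationContinuityZ3.Theorems.FreeBoxSparse.InfiniteReduction
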